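import Mathlib
import Literature.Computability.AlgebraicComplexity.NewtonPolygonTauBounds

/-!
# Crux `NewtonTauWeak` (stmt-ValiantsHypothesis-5904), line `slope-ladder`: the split-parallelogram obstruction

The geometric core of the census of `stub_blockConvexBound` (`Cruxes/NewtonTauWeak/CENSUS-stub_blockConvexBound-valwidth-p1.md`,
§2(a)): WHY every "full-box" construction of many points of an `r`-fold Minkowski sum on a convex arc needs, for every
bipartition of the `r` summands, one side whose index directions span — and hence why the Lagrange mechanism
(`…BlockConvexLagrange`, exponent `k/(2k-1)`) is optimal in its class.

* `no_parallelogram_on_graph` — four points `p, p+u, p+v, p+u+v` with `u, v ≠ 0` never all lie on the graph of a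
  strictly convex function (the secant increments `y ↦ φ(y+a) - φ(y)` are strictly monotone,
  `KPTT.Szekely.strictMono_sub`).
* `sum_add_sum_eq_mix` — for two choice functions `p q : ι → ℝ²` and a set `I` of indices, the four sums
  `Σ p`, `Σ q`, `Σ mix_I`, `Σ mix_{Iᶜ}` (swap the `I`-coordinates) form a (possibly degenerate) parallelogram.
* `no_split_parallelogram` — hence if all four of these sums of points of `P_1, …, P_r` lie on a strictly convex
  graph, one of the two half-differences `Σ_{i∈I}(q_i - p_i)`, `Σ_{i∉I}(q_i - p_i)` vanishes.  For index boxes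
  `t ∈ [n]^k` with summands read through integer linear forms `μ_1,…,μ_r`, nonzero half-differences exist as soon as
  neither `{μ_i : i ∈ I}` nor `{μ_i : i ∉ I}` spans `ℚ^k`; so `r ≥ 2k-1` (census §2(a)).

Helper for the crux item (`--supports`); nothing here bears on `NewtonTauWeak` or `VP ≠ VNP`.
-/

set_option linter.dupNamespace false

namespace Summit.ValiantsHypothesis.ValiantsHypothesis.Theorems.NewtonFramesNewtonTauWeak.BlockConvexParallelogram

open scoped BigOperators
open Set
open Literature.Computability.AlgebraicComplexity.KPTT.Szekely (strictMono_sub)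

noncomputable section

/-- **No parallelogram on a strictly convex graph.** If `φ` is strictly convex and the four planar points
`p, p+u, p+v, p+u+v` all satisfy `z₁ = φ(z₀)`, then `u = 0` or `v = 0`.  (With `a = u₀`, `b = v₀`:
`φ(x+a+b) - φ(x+b) = φ(x+a) - φ(x)`, but `y ↦ φ(y+a) - φ(y)` is strictly monotone for `a ≠ 0`; and `a = 0` forces
`u = 0` on a graph.) [folklore] -/
theorem no_parallelogram_on_graph {φ : ℝ → ℝ} (hφ : StrictConvexOn ℝ univ φ) (p u v : Fin 2 → ℝ)
    (h00 : p 1 = φ (p 0)) (h10 : (p + u) 1 = φ ((p + u) 0)) (h01 : (p + v) 1 = φ ((p + v) 0))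
    (h11 : (p + u + v) 1 = φ ((p + u + v) 0)) : u = 0 ∨ v = 0 := by
  simp only [Pi.add_apply] at h10 h01 h11
  by_cases ha : u 0 = 0
  · -- same abscissa for `p` and `p+u` on a graph: `u = 0`
    left
    funext i
    fin_cases i
    · exact ha
    · show u 1 = 0
      rw [ha, add_zero] at h10
      linarith
  by_cases hb : v 0 = 0
  · right
    funext i
    fin_cases i
    · exact hb
    · show v 1 = 0
      rw [hb, add_zero] at h01
      linarith
  -- both abscissa increments nonzero: contradiction with strict monotonicity of secant increments
  exfalso
  have key : φ (p 0 + v 0 + u 0) - φ (p 0 + v 0) = φ (p 0 + u 0) - φ (p 0) := by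
    have e : p 0 + u 0 + v 0 = p 0 + v 0 + u 0 := by ring
    rw [e] at h11
    linarith
  rcases lt_or_gt_of_ne ha with hneg | hpos
  · -- u 0 < 0 : y ↦ φ (y + 0) - φ (y + u 0) is strictly monotone
    have hm := strictMono_sub hφ hneg
    have hinj := hm.injective
    have : (fun y => φ (y + 0) - φ (y + u 0)) (p 0 + v 0) = (fun y => φ (y + 0) - φ (y + u 0)) (p 0) := by
      simp only [add_zero]
      linarith
    have := hinj this
    exact hb (by linarith)
  · have hm := strictMono_sub hφ hpos
    have hinj := hm.injective
    have : (fun y => φ (y + u 0) - φ (y + 0)) (p 0 + v 0) = (fun y => φ (y + u 0) - φ (y + 0)) (p 0) := by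
      simp only [add_zero]
      linarith
    have := hinj this
    exact hb (by linarith)

/-- **The four mixed sums form a parallelogram**: `Σ p + Σ q = Σ mix_I(p,q) + Σ mix_I(q,p)`, where `mix_I(p,q)`
takes `q` on `I` and `p` off `I`. [folklore] -/
theorem sum_add_sum_eq_mix {ι : Type*} (s I : Finset ι) [DecidablePred (· ∈ I)] (p q : ι → Fin 2 → ℝ) :
    ∑ i ∈ s, p i + ∑ i ∈ s, q i =
      ∑ i ∈ s, (if i ∈ I then q i else p i) + ∑ i ∈ s, (if i ∈ I then p i else q i) := by
  rw [← Finset.sum_add_distrib, ← Finset.sum_add_distrib]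
  refine Finset.sum_congr rfl fun i _ => ?_
  by_cases hi : i ∈ I <;> simp [hi, add_comm]

/-- The half-differences: `Σ mix_I(p,q) - Σ p = Σ_{i ∈ s ∩ I} (q_i - p_i)` and
`Σ mix_I(q,p) - Σ p = Σ_{i ∈ s \ I} (q_i - p_i)`. [folklore] -/
theorem mix_sub_sum {ι : Type*} (s I : Finset ι) [DecidablePred (· ∈ I)] (p q : ι → Fin 2 → ℝ) :
    ∑ i ∈ s, (if i ∈ I then q i else p i) - ∑ i ∈ s, p i = ∑ i ∈ s.filter (· ∈ I), (q i - p i) ∧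
    ∑ i ∈ s, (if i ∈ I then p i else q i) - ∑ i ∈ s, p i = ∑ i ∈ s.filter (· ∉ I), (q i - p i) := by
  constructor
  · rw [← Finset.sum_sub_distrib, Finset.sum_filter]
    refine Finset.sum_congr rfl fun i _ => ?_
    by_cases hi : i ∈ I <;> simp [hi]
  · rw [← Finset.sum_sub_distrib, Finset.sum_filter]
    refine Finset.sum_congr rfl fun i _ => ?_
    by_cases hi : i ∈ I <;> simp [hi]

/-- **Split-parallelogram obstruction for sums on a convex graph.**  Let `p, q` be two choices of one point from each
summand (`i ∈ s`), `I` a set of indices, and suppose the four sums `Σ p`, `Σ mix_I(p,q)`, `Σ mix_I(q,p)`, `Σ q` all lie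
on the graph of a strictly convex `φ`.  Then one of the half-differences `Σ_{i∈s∩I}(q_i - p_i)`, `Σ_{i∈s∖I}(q_i - p_i)`
is zero.  (So a family of representing tuples of distinct points of `P_1 + ⋯ + P_r` on a convex arc contains no
"split parallelogram"; census §2(a).) [this file] -/
theorem no_split_parallelogram {φ : ℝ → ℝ} (hφ : StrictConvexOn ℝ univ φ) {ι : Type*} (s I : Finset ι)
    [DecidablePred (· ∈ I)] (p q : ι → Fin 2 → ℝ)
    (hp : (∑ i ∈ s, p i) 1 = φ ((∑ i ∈ s, p i) 0))
    (hI : (∑ i ∈ s, (if i ∈ I then q i else p i)) 1 = φ ((∑ i ∈ s, (if i ∈ I then q i else p i)) 0))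
    (hIc : (∑ i ∈ s, (if i ∈ I then p i else q i)) 1 = φ ((∑ i ∈ s, (if i ∈ I then p i else q i)) 0))
    (hq : (∑ i ∈ s, q i) 1 = φ ((∑ i ∈ s, q i) 0)) :
    ∑ i ∈ s.filter (· ∈ I), (q i - p i) = 0 ∨ ∑ i ∈ s.filter (· ∉ I), (q i - p i) = 0 := by
  obtain ⟨hu, hv⟩ := mix_sub_sum s I p q
  set P := ∑ i ∈ s, p i with hP
  set u := ∑ i ∈ s.filter (· ∈ I), (q i - p i) with hu'
  set v := ∑ i ∈ s.filter (· ∉ I), (q i - p i) with hv'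
  have e1 : ∑ i ∈ s, (if i ∈ I then q i else p i) = P + u := by rw [← hu]; abel
  have e2 : ∑ i ∈ s, (if i ∈ I then p i else q i) = P + v := by rw [← hv]; abel
  have e3 : ∑ i ∈ s, q i = P + u + v := by
    have h := sum_add_sum_eq_mix s I p q
    rw [e1, e2] at h
    -- P + Σ q = (P + u) + (P + v)
    have : ∑ i ∈ s, q i = P + u + v := by
      have h' : ∑ i ∈ s, q i = (P + u) + (P + v) - P := by rw [← h]; abel
      rw [h']; abel
    exact this
  rw [e1] at hI
  rw [e2] at hIc
  rw [e3] at hq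
  exact no_parallelogram_on_graph hφ P u v hp hI hIc hq

end

end Summit.ValiantsHypothesis.ValiantsHypothesis.Theorems.NewtonFramesNewtonTauWeak.BlockConvexParallelogram
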